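import Summits.NavierStokesRegularity.NavierStokesRegularity.Theorems.ExtremiserTransienceWeakClassPressureWindow
import Literature.Analysis.FluidPDE.ClassicalLocalEnergyCutoff
import Literature.Analysis.FluidPDE.WeakGradientIBP
import Literature.Analysis.FluidPDE.WholeSpaceIBP
import HarnessLib

/-!
# Route `ExtremiserTransience`, LINE g5-α repair (seat ns-idea-5 g5): the HEAD of the local energy budget — LEI with ball cutoff, pressure in gauge-free Riesz form

`--supports stmt-NavierStokesRegularity-27823` (the subcubic local energy budget, p639422) — recipe step 3 of the line card §RECIPE, DONE.
Route-independent module.  For a member `(W, K)` of the weak one-slice class, every `t₀ < 0` and every `ρ > 0`, with the tree's cutoff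
`χ_ρ = cutoff ρ` (`= 1` on `B_ρ`, `= 0` off `B_{2ρ}`, `|∇χ_ρ| ≤ C/ρ`, `|Δχ_ρ| ≤ C/ρ²`):
`∫ χ_ρ |W(t₀)|² ≤ ∫ χ_ρ |W(t₀ − ρ²)|² + ∫_{t₀−ρ²}^{t₀} ∫ ( Δχ_ρ |W|² + Dχ_ρ(W)|W|² + 2 (Q̃_s(x) − Q̃_s(0)) Dχ_ρ(W) )`,
where `Q̃_s = pressurePotentialMod 0 (W s)` is the Riesz pressure modulo constants.  Ingredients: the classical pressure `q` with its identification
`q(s,·) = Q̃_s + c(s)` (`weakClass_pressure_window`, p640125), the integrated local energy identity `IsClassicalNSSolutionOn.local_energy_identity_cutoff`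
(dissipation dropped), and GAUGE REMOVAL: `∫ c · Dχ(W s) = 0` for constants because `W s` is weakly divergence-free
(`IsWeaklyDivFree.integral_fderiv_apply_eq_zero`; lemma `integral_mul_fderiv_apply_eq_of_sub_const` below).  What remains of the 27823 budget after
this file: bound the right-hand side by `C(K, t₀) ρ^{5/2}` for `ρ ≥ 1` using `√(−s)‖W s‖ ≤ K`, the cutoff bounds and `weakClass_pressureOsc` (p640175)
— elementary (§RECIPE step 4).  HONEST FRAMING: bookkeeping for hypothetical blow-up limits; nothing about Navier–Stokes regularity or blow-up is
proved here and no summit is proved by a line. [cite: CaffarelliKohnNirenberg1982, §2 (2.5)]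
-/

noncomputable section

namespace Summit.NavierStokesRegularity.NavierStokesRegularity.Theorems.ExtremiserTransience
set_option linter.dupNamespace false

open Set Function MeasureTheory Filter Topology
open scoped RealInnerProductSpace ContDiff Laplacian
open Literature.Analysis Literature.Analysis.FluidPDE

/-- **Gauge removal**: against `Dφ(a)` with `a` weakly divergence-free and `φ ∈ C_c^∞`, a continuous weight `g` may be shifted by any constant.
[folklore] -/
theorem integral_mul_fderiv_apply_eq_of_sub_const {a : EuclideanSpace ℝ (Fin 3) → EuclideanSpace ℝ (Fin 3)} (ha : IsWeaklyDivFree a)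
    (hac : Continuous a) {g : EuclideanSpace ℝ (Fin 3) → ℝ} (hg : Continuous g) {φ : EuclideanSpace ℝ (Fin 3) → ℝ} (hφ : ContDiff ℝ ∞ φ)
    (hφc : HasCompactSupport φ) (c : ℝ) :
    ∫ x, g x * fderiv ℝ φ x (a x) = ∫ x, (g x - c) * fderiv ℝ φ x (a x) := by
  have hDφc : HasCompactSupport (fderiv ℝ φ) := hφc.fderiv (𝕜 := ℝ)
  have hDφ : Continuous (fderiv ℝ φ) := hφ.continuous_fderiv (by simp)
  have hF : Continuous fun x => fderiv ℝ φ x (a x) := hDφ.clm_apply hac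
  have hFc : HasCompactSupport fun x => fderiv ℝ φ x (a x) := by
    refine hDφc.mono (Function.support_subset_iff'.2 fun x hx => ?_)
    rw [Function.notMem_support] at hx
    simp [hx]
  have hI1 : Integrable (fun x => fderiv ℝ φ x (a x)) volume := hF.integrable_of_hasCompactSupport hFc
  have hI2 : Integrable (fun x => φ x • a x) volume :=
    (hφ.continuous.smul hac).integrable_of_hasCompactSupport hφc.smul_right
  have hzero := ha.integral_fderiv_apply_eq_zero hac.aestronglyMeasurable hφ hI1 hI2
  have hIg : Integrable (fun x => g x * fderiv ℝ φ x (a x)) volume :=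
    (hg.mul hF).integrable_of_hasCompactSupport hFc.mul_left
  have hIc : Integrable (fun x => c * fderiv ℝ φ x (a x)) volume := hI1.const_mul c
  have e : (fun x => (g x - c) * fderiv ℝ φ x (a x)) = fun x => g x * fderiv ℝ φ x (a x) - c * fderiv ℝ φ x (a x) := by
    funext x; ring
  rw [e, integral_sub hIg hIc, integral_const_mul, hzero, mul_zero, sub_zero]

/-- **Head of the local energy budget** for weak-class fields: LEI on `[t₀ − ρ², t₀]` with the cutoff `cutoff ρ`, dissipation dropped, pressure in
the gauge-free Riesz form `Q̃_s(x) − Q̃_s(0)`. [cite: CaffarelliKohnNirenberg1982, §2 (2.5)] -/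
theorem weakClass_localEnergy_head (W : ℝ → EuclideanSpace ℝ (Fin 3) → EuclideanSpace ℝ (Fin 3)) (K : ℝ)
    (hcont : ContinuousOn (Function.uncurry W) (Set.Iio (0 : ℝ) ×ˢ Set.univ))
    (hmild : ∀ s t : ℝ, s < t → t < 0 → ∀ x, W t x =
      Literature.Analysis.FluidPDE.heatFlow (W s) (t - s) x - Literature.Analysis.FluidPDE.oseenDuhamel 1 s W W t x)
    (hdec : ∀ t : ℝ, t < 0 → ∀ x, Real.sqrt (-t) * ‖W t x‖ ≤ K) {t₀ ρ : ℝ} (ht₀ : t₀ < 0) (hρ : 0 < ρ) :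
    ∫ x, cutoff ρ x * ‖W t₀ x‖ ^ 2 ≤
      (∫ x, cutoff ρ x * ‖W (t₀ - ρ ^ 2) x‖ ^ 2) +
        ∫ s in (t₀ - ρ ^ 2)..t₀, ∫ x, ((Δ (cutoff ρ : EuclideanSpace ℝ (Fin 3) → ℝ)) x * ‖W s x‖ ^ 2 +
          fderiv ℝ (cutoff ρ) x (W s x) * ‖W s x‖ ^ 2 +
          2 * ((pressurePotentialMod 0 (W s) x - pressurePotentialMod 0 (W s) 0) * fderiv ℝ (cutoff ρ) x (W s x))) := by
  have hwdiv := weakClass_isWeaklyDivFree W K hcont hmild hdec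
  obtain ⟨K₁, -, hg⟩ := weakClass_gradTypeI W K hcont hmild hdec
  have hT : t₀ - ρ ^ 2 - 1 < 0 := by nlinarith
  obtain ⟨q, hq, hid⟩ := weakClass_pressure_window W K hcont hmild hdec hT
  set φ : EuclideanSpace ℝ (Fin 3) → ℝ := cutoff ρ with hφdef
  have hφ : ContDiff ℝ ∞ φ := contDiff_cutoff ρ
  have hφc : HasCompactSupport φ := hasCompactSupport_cutoff hρ
  have hle : t₀ - ρ ^ 2 ≤ t₀ := by nlinarith
  have hI : Icc (t₀ - ρ ^ 2) t₀ ⊆ Ioo (t₀ - ρ ^ 2 - 1) 0 := fun s hs => ⟨by linarith [hs.1], lt_of_le_of_lt hs.2 ht₀⟩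
  have hLEI := hq.local_energy_identity_cutoff isOpen_Ioo hφ hφc hle hI
  simp only [one_mul, mul_one] at hLEI
  -- the dissipation is nonnegative
  have hdiss : 0 ≤ ∫ s in (t₀ - ρ ^ 2)..t₀, ∫ x, frobeniusNormSq (fderiv ℝ (W s) x) * φ x :=
    intervalIntegral.integral_nonneg hle fun s _ =>
      integral_nonneg fun x => mul_nonneg (frobeniusNormSq_nonneg _) (cutoff_nonneg ρ x)
  -- gauge removal inside the time integral: replace `q s` by `Q̃_s − Q̃_s(0)`
  have hDφ : Continuous (fderiv ℝ φ) := hφ.continuous_fderiv (by simp)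
  have hDφc : HasCompactSupport (fderiv ℝ φ) := hφc.fderiv (𝕜 := ℝ)
  have hΔφ : Continuous (Δ φ) := continuous_laplacian (hφ.of_le (by norm_cast))
  have hΔφc : HasCompactSupport (Δ φ) :=
    hφc.mono' fun x hx => by
      by_contra h
      exact hx (laplacian_eq_zero_of_notMem_tsupport h)
  have hflux : ∀ s ∈ uIcc (t₀ - ρ ^ 2) t₀,
      (∫ x, ((Δ φ) x * ‖W s x‖ ^ 2 + fderiv ℝ φ x (W s x) * ‖W s x‖ ^ 2 + 2 * (q s x * fderiv ℝ φ x (W s x)))) =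
        ∫ x, ((Δ φ) x * ‖W s x‖ ^ 2 + fderiv ℝ φ x (W s x) * ‖W s x‖ ^ 2 +
          2 * ((pressurePotentialMod 0 (W s) x - pressurePotentialMod 0 (W s) 0) * fderiv ℝ φ x (W s x))) := by
    intro s hs
    rw [uIcc_of_le hle] at hs
    have hsS : s ∈ Ioo (t₀ - ρ ^ 2 - 1) 0 := hI hs
    have hs0 : s < 0 := hsS.2
    have hWc : Continuous (W s) := (hg s hs0).1.continuous
    have hqc : Continuous (q s) := by
      have h1 := hq.smooth_pressure.continuousOn
      exact h1.comp_continuous (continuous_const.prodMk continuous_id) fun x => ⟨hsS, mem_univ _⟩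
    obtain ⟨c, hc⟩ := hid s hsS 0
    -- integrability of the common part and of the two pressure parts
    have hF : Continuous fun x => fderiv ℝ φ x (W s x) := hDφ.clm_apply hWc
    have hFc : HasCompactSupport fun x => fderiv ℝ φ x (W s x) := by
      refine hDφc.mono (Function.support_subset_iff'.2 fun x hx => ?_)
      rw [Function.notMem_support] at hx
      simp [hx]
    have hA : Integrable (fun x => (Δ φ) x * ‖W s x‖ ^ 2 + fderiv ℝ φ x (W s x) * ‖W s x‖ ^ 2) volume :=
      ((hΔφ.mul (hWc.norm.pow 2)).integrable_of_hasCompactSupport hΔφc.mul_right).add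
        ((hF.mul (hWc.norm.pow 2)).integrable_of_hasCompactSupport hFc.mul_right)
    have hP1 : Integrable (fun x => 2 * (q s x * fderiv ℝ φ x (W s x))) volume :=
      ((hqc.mul hF).integrable_of_hasCompactSupport hFc.mul_left).const_mul 2
    have hPc : Continuous fun x => pressurePotentialMod 0 (W s) x - pressurePotentialMod 0 (W s) 0 := by
      have e : (fun x => pressurePotentialMod 0 (W s) x - pressurePotentialMod 0 (W s) 0) = fun x => q s x - (c + pressurePotentialMod 0 (W s) 0) := by
        funext x; rw [hc x]; ring
      rw [e]; exact hqc.sub continuous_const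
    have hP2 : Integrable (fun x => 2 * ((pressurePotentialMod 0 (W s) x - pressurePotentialMod 0 (W s) 0) * fderiv ℝ φ x (W s x))) volume :=
      ((hPc.mul hF).integrable_of_hasCompactSupport hFc.mul_left).const_mul 2
    rw [integral_add hA hP1, integral_add hA hP2, integral_const_mul, integral_const_mul]
    congr 2
    rw [integral_mul_fderiv_apply_eq_of_sub_const (hwdiv s hs0) hWc hqc hφ hφc (c + pressurePotentialMod 0 (W s) 0)]
    refine integral_congr_ae (Eventually.of_forall fun x => ?_)
    simp only
    rw [hc x]
    ring
  rw [intervalIntegral.integral_congr hflux] at hLEI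
  linarith

end Summit.NavierStokesRegularity.NavierStokesRegularity.Theorems.ExtremiserTransience

end
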